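import Mathlib.Analysis.SpecialFunctions.Gamma.Beta
import Mathlib.Analysis.SpecialFunctions.Trigonometric.Basic
import Literature.Analysis.SpecialFunctions.EquianharmonicConstant
import HarnessLib

/-!
# Beta values at thirds

Closed forms for the three non-rational Beta values `B(a,b) = Γ(a)Γ(b)/Γ(a+b)` with
`a, b ∈ {1/3, 2/3}`:

* `B(1/3, 1/3) = √3 · Γ(1/3)³ / (2π)`,
* `B(1/3, 2/3) = 2π / √3`,
* `B(2/3, 2/3) = 4π² / Γ(1/3)³`.

All three follow from Euler's reflection formula `Γ(1/3)Γ(2/3) = π / sin(π/3) = 2π/√3`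
(the tree's `Literature.Analysis.SpecialFunctions.Gamma_one_third_mul_Gamma_two_thirds`),
`Γ(1) = 1` and the functional equation `Γ(4/3) = (1/3)·Γ(1/3)`.
-/

open Literature.Analysis.SpecialFunctions (Gamma_one_third_mul_Gamma_two_thirds)

namespace Summit.KontsevichZagierPeriods.FermatIsogeny.BetaLinearSector.Thirds

/-- `Γ(2/3) = 2π / (√3 · Γ(1/3))`, the reflection formula solved for `Γ(2/3)`. [folklore] -/
theorem thirds_Gamma_two_thirds_eq :
    Real.Gamma (2 / 3) = 2 * Real.pi / (Real.sqrt 3 * Real.Gamma (1 / 3)) := by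
  have h13 : Real.Gamma (1 / 3) ≠ 0 := (Real.Gamma_pos_of_pos (by norm_num)).ne'
  have hs : Real.sqrt 3 ≠ 0 := by positivity
  have hrefl := Gamma_one_third_mul_Gamma_two_thirds
  rw [eq_div_iff (mul_ne_zero hs h13)]
  rw [eq_div_iff hs] at hrefl
  linear_combination hrefl

/-- `Γ(4/3) = Γ(1/3)/3` (functional equation `Γ(s+1) = s·Γ(s)` at `s = 1/3`). [folklore] -/
theorem thirds_Gamma_four_thirds_eq :
    Real.Gamma (2 / 3 + 2 / 3) = 1 / 3 * Real.Gamma (1 / 3) := by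
  rw [show (2 / 3 : ℝ) + 2 / 3 = 1 / 3 + 1 by norm_num,
    Real.Gamma_add_one (by norm_num : (1 / 3 : ℝ) ≠ 0)]

/-- The three non-rational Beta values at thirds in closed form:
`B(1/3,1/3) = √3·Γ(1/3)³/(2π)`, `B(1/3,2/3) = 2π/√3`, `B(2/3,2/3) = 4π²/Γ(1/3)³`
(Euler reflection `Γ(1/3)Γ(2/3) = 2π/√3`, `Γ(1) = 1`, `Γ(4/3) = Γ(1/3)/3`).
[cite: AndrewsAskeyRoy1999, Thm 1.1.4] -/
theorem stub_betaValuesThird :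
    Real.Gamma (1/3) * Real.Gamma (1/3) / Real.Gamma (1/3 + 1/3) =
        Real.sqrt 3 * Real.Gamma (1/3) ^ 3 / (2 * Real.pi) ∧
      Real.Gamma (1/3) * Real.Gamma (2/3) / Real.Gamma (1/3 + 2/3) = 2 * Real.pi / Real.sqrt 3 ∧
      Real.Gamma (2/3) * Real.Gamma (2/3) / Real.Gamma (2/3 + 2/3) =
        4 * Real.pi ^ 2 / Real.Gamma (1/3) ^ 3 := by
  have h13 : Real.Gamma (1 / 3) ≠ 0 := (Real.Gamma_pos_of_pos (by norm_num)).ne'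
  have hs : Real.sqrt 3 ≠ 0 := by positivity
  have hπ : Real.pi ≠ 0 := Real.pi_ne_zero
  have hs3 : Real.sqrt 3 ^ 2 = 3 := Real.sq_sqrt (by norm_num : (0 : ℝ) ≤ 3)
  refine ⟨?_, ?_, ?_⟩
  · -- B(1/3,1/3) = Γ(1/3)² / Γ(2/3)
    rw [show (1 / 3 : ℝ) + 1 / 3 = 2 / 3 by norm_num, thirds_Gamma_two_thirds_eq]
    field_simp
  · -- B(1/3,2/3) = Γ(1/3)Γ(2/3) / Γ(1)
    rw [show (1 / 3 : ℝ) + 2 / 3 = 1 by norm_num, Real.Gamma_one, div_one]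
    exact Gamma_one_third_mul_Gamma_two_thirds
  · -- B(2/3,2/3) = Γ(2/3)² / Γ(4/3)
    rw [thirds_Gamma_four_thirds_eq, thirds_Gamma_two_thirds_eq]
    field_simp
    rw [hs3]
    ring

end Summit.KontsevichZagierPeriods.FermatIsogeny.BetaLinearSector.Thirds
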